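import Mathlib
import HarnessLib

/-!
# Markman 2025 — LEMMA 2.2.1: the secant plane `P` is isotropic iff `W₁ ∩ W₂ ≠ 0`, definite iff `W₁ ∩ W₂ = 0` —
# the printed proof's algebra («`λ₁ = a + ib`», `(λ₁, λ₁) = (a,a) − (b,b) + 2i(a,b)`, `(λ₁, λ₂) = (a,a) + (b,b)`),
# kernel-checked, with one reading precision

E. Markman: [M] *Cycles on abelian 2n-folds of Weil type from secant sheaves on abelian n-folds*,
arXiv:2502.03415 **v2** (2025-06-08), bib `Markman2025SecantWeil` — UNREFEREED PREPRINT. Pages/lines = PyMuPDF lines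
of the public v2 PDF (sha256/16 `8155aa33870069b8`), read at seat lit-w-markman g15 (pub-hsemireg LIT-W, 2026-08-23;
sheet `LOCATOR-SHEET-MARKMAN.md` §49), BY EYE on the 160-dpi render `HOME/lit/Markman-renders-litw-markman-g15/`
`r_mar25_v2_p13_L221.png`. Lemma 2.2.1 feeds Assumption 2.4.1 («`P` is non-isotropic») and hence «`W₁ ∩ W₂ = (0)`»
(p. 14 L24–25), used throughout §2.4, §3, §10.  SCOPE (second reader lit-3 g46, pub-hsemireg bus l.14729): the
pairing (1.2.3) on `S` is «symmetric for even `n` and anti-symmetric for odd `n`» (v2 p. 4 L5–7); the displayed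
computation of the printed proof — hence this file's standing hypothesis `hB` (`B` symmetric) and the «definite»
clause — is the even-`n` case; for odd `n` the pairing on `S⁺_ℚ` is alternating, the «definite» clause of Lemma 2.2.1
is empty, and Assumption 2.4.1's «non-isotropic ⇒ `W₁ ∩ W₂ = (0)`» reads through [Ch, III.2.4] alone.

## What is printed (verbatim, v2, p. 13 L6–31)
«Let `K` be a purely imaginary quadratic number field. Let `ℓ₁, ℓ₂` be two complex conjugate points in `ℙ(S⁺_K)`. Assume
that the line `ℓ̃_i` in `S⁺_K` corresponding to `ℓ_i` is spanned by a pure spinor. Let `W_i ⊂ V_K` be the maximal isotropic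
subspace of `V_K` corresponding to `ℓ_i`. Note that `W₂` is the complex conjugate of `W₁`. Let `P_K` be the plane in
`S⁺_K` spanned by `ℓ̃₁` and `ℓ̃₂`. `P_K` is defined over `ℚ` and we denote by `P` the corresponding subspace of `S⁺_ℚ`.
LEMMA 2.2.1. `P` is isotropic with respect to the pairing `(•, •)_S`, given in (1.2.3), if and only if `W₁ ∩ W₂ ≠ (0)`.
The restriction of the pairing `(•, •)_S` to `P` is definite, if and only if `W₁ ∩ W₂ = (0)`.
Proof. Let `λ₁` be a non-zero element of `ℓ̃₁` and set `λ₂ = λ̄₁`. Then `(λ_i, λ_i) = 0`, for `i = 1, 2`, by [Ch, III.2.4].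
Furthermore, `(λ₁, λ₂) = 0`, if and only if `W₁ ∩ W₂ ≠ (0)`, by [Ch, III.2.4]. Write `λ₁ = a + ib`, with `a, b ∈ S⁺_ℚ`.
Then `(λ₁, λ₁) = (a, a)_S − (b, b)_S + 2i(a, b)_S = 0`, `(λ₁, λ₂) = (a, a)_S + (b, b)_S`. The first equation implies that
`(a, a) = (b, b)` and `(a, b) = 0`. The second equation thus implies that `(a, a) = 0`, if and only if `W₁ ∩ W₂ ≠ 0`. □»

## What this file proves (0 named facts, 0 sorry) — and a READING PRECISION (P-2.2.1, this seat ×1)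
MODEL: `S` a vector space over a field `F` (for `S⁺_ℚ`) with a symmetric bilinear form `B` (for `(•, •)_S`); the
scalar extension to `K = F(√−d)` is written on PAIRS `(a, b) ↔ a + √−d·b`: the `K`-bilinear extension has «real
part» `reK B d x y = B(a, a′) − d·B(b, b′)` and «imaginary part» `imK B x y = B(a, b′) + B(b, a′)`, conjugation
`conjK (a, b) = (a, −b)`. P-2.2.1 (a reading precision, not an erratum): the text writes «`λ₁ = a + ib`, with
`a, b ∈ S⁺_ℚ`»; for `K = ℚ(√−d)` one has `λ₁ = a′ + √−d·b′` with `a′, b′ ∈ S⁺_ℚ`, so `b = √d·b′` is rational only when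
`d` is a square (`K = ℚ(i)`) — but the argument needs only `a, b` REAL (`S⁺_ℝ`), where the displays hold verbatim (the
case `d = 1` of the model over `F = ℝ`: `display_d_one`), or equivalently one keeps `a′, b′ ∈ S⁺_ℚ` and reads the
displays with `√−d` for `i`: `(λ₁, λ₁) = (a,a) − d(b,b) + 2√−d(a,b)`, `(λ₁, λ̄₁) = (a,a) + d(b,b)` (the general form
proved here); the CONCLUSIONS ARE UNCHANGED because `d > 0`. THEOREMS: `self_pairing` / `conj_pairing` (the two
displays), `first_equation` («implies that `(a,a) = d(b,b)` and `(a,b) = 0`», characteristic `≠ 2`), `second_equation`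
(then `(λ₁, λ₂) = 2d(b,b) = 2(a,a)`, so «`(a,a) = 0` iff `(λ₁, λ₂) = 0`» — and «`(λ₁, λ₂) = 0` iff `W₁ ∩ W₂ ≠ (0)`» is
[Ch, III.2.4], BY VALUE), `plane_spanned_by_a_b` (`λ₁ + λ₂ = 2a`, `λ₁ − λ₂ = 2√−d·b`: `P_K = span{a, b}`),
`gram_on_P` (the form on `span{a, b}`: `Q(x a + y b) = (b,b)(d x² + y²)`), `isotropic_iff` (`Q ≡ 0` on `P` iff `(a,a) = 0`,
for `d ≠ 0`), `definite_of_ne` / `definite_iff` (over an ordered field with `d > 0`: `Q` has no non-trivial zero iff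
`(a,a) ≠ 0` — «definite, if and only if `W₁ ∩ W₂ = (0)`» modulo [Ch]). BY VALUE: [Ch, III.2.4] (both uses), pure
spinors, `P_K` defined over `ℚ`. Nothing in this file says that HC / HC_CM / HC_AV is proved or that any object is
semiregular or hyperholomorphic.
-/

namespace Literature.AlgebraicGeometry.Markman2025.SecantPlane

section General

variable {F : Type*} [Field F] {S : Type*} [AddCommGroup S] [Module F S]

/-- «real part» of the `K`-bilinear extension of `B` on `a + √−d b`, `a′ + √−d b′` (`(√−d)² = −d`):
`B(a, a′) − d·B(b, b′)`. A MODEL of the scalar extension `S⁺_K = S⁺_ℚ ⊗ K`. [cite: Markman2025SecantWeil, Lemma 2.2.1 (proof), p. 13 L21–28] -/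
def reK (B : S →ₗ[F] S →ₗ[F] F) (d : F) (x y : S × S) : F :=
  B x.1 y.1 - d * B x.2 y.2

/-- «imaginary part» (coefficient of `√−d`): `B(a, b′) + B(b, a′)`. [cite: Markman2025SecantWeil, Lemma 2.2.1 (proof), p. 13 L21–28] -/
def imK (B : S →ₗ[F] S →ₗ[F] F) (x y : S × S) : F :=
  B x.1 y.2 + B x.2 y.1

/-- complex conjugation `a + √−d b ↦ a − √−d b` («set `λ₂ = λ̄₁`»). [cite: Markman2025SecantWeil, Lemma 2.2.1 (proof), p. 13 L19] -/
def conjK (x : S × S) : S × S :=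
  (x.1, -x.2)

/-- First display (general `d`): `(λ₁, λ₁) = (a,a) − d(b,b) + 2√−d(a,b)` for `λ₁ = a + √−d b` and `B` symmetric.
[cite: Markman2025SecantWeil, Lemma 2.2.1 (proof), p. 13 L23–25] -/
theorem self_pairing (B : S →ₗ[F] S →ₗ[F] F) (hB : ∀ u v, B u v = B v u) (d : F) (a b : S) :
    reK B d (a, b) (a, b) = B a a - d * B b b ∧ imK B (a, b) (a, b) = 2 * B a b := by
  refine ⟨rfl, ?_⟩
  simp only [imK, hB b a]
  ring

/-- Second display (general `d`): `(λ₁, λ̄₁) = (a,a) + d(b,b)` (and its `√−d`-part vanishes).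
[cite: Markman2025SecantWeil, Lemma 2.2.1 (proof), p. 13 L26–28] -/
theorem conj_pairing (B : S →ₗ[F] S →ₗ[F] F) (hB : ∀ u v, B u v = B v u) (d : F) (a b : S) :
    reK B d (a, b) (conjK (a, b)) = B a a + d * B b b ∧ imK B (a, b) (conjK (a, b)) = 0 := by
  simp only [reK, imK, conjK, map_neg, hB b a]
  constructor <;> ring

/-- The PRINTED displays are the case `d = 1` (`√−d = i`): «`(λ₁, λ₁) = (a, a)_S − (b, b)_S + 2i(a, b)_S`»,
«`(λ₁, λ₂) = (a, a)_S + (b, b)_S`». [cite: Markman2025SecantWeil, Lemma 2.2.1 (proof), p. 13 L21–28] -/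
theorem display_d_one (B : S →ₗ[F] S →ₗ[F] F) (hB : ∀ u v, B u v = B v u) (a b : S) :
    reK B 1 (a, b) (a, b) = B a a - B b b ∧ imK B (a, b) (a, b) = 2 * B a b
      ∧ reK B 1 (a, b) (conjK (a, b)) = B a a + B b b := by
  refine ⟨by simp [reK], (self_pairing B hB 1 a b).2, ?_⟩
  rw [(conj_pairing B hB 1 a b).1, one_mul]

/-- «The first equation implies that `(a, a) = (b, b)` and `(a, b) = 0`» — general `d`: `(λ₁, λ₁) = 0` (both parts) gives
`(a,a) = d(b,b)` and `(a,b) = 0` (characteristic `≠ 2`). [cite: Markman2025SecantWeil, Lemma 2.2.1 (proof), p. 13 L29] -/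
theorem first_equation (B : S →ₗ[F] S →ₗ[F] F) (hB : ∀ u v, B u v = B v u) (h2 : (2 : F) ≠ 0) (d : F) (a b : S)
    (hre : reK B d (a, b) (a, b) = 0) (him : imK B (a, b) (a, b) = 0) : B a a = d * B b b ∧ B a b = 0 := by
  rw [(self_pairing B hB d a b).2] at him
  refine ⟨?_, ?_⟩
  · simp only [reK] at hre
    linear_combination hre
  · rcases mul_eq_zero.mp him with h | h
    · exact absurd h h2
    · exact h

/-- «The second equation thus implies that `(a, a) = 0`, if and only if `W₁ ∩ W₂ ≠ 0`» — the algebra: under the first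
equation `(λ₁, λ₂) = (a,a) + d(b,b) = 2(a,a)`, so `(λ₁, λ₂) = 0 ↔ (a,a) = 0` (characteristic `≠ 2`); «`(λ₁, λ₂) = 0` iff
`W₁ ∩ W₂ ≠ (0)`» is [Ch, III.2.4], by value. [cite: Markman2025SecantWeil, Lemma 2.2.1 (proof), p. 13 L20–21 / L29–30] -/
theorem second_equation (B : S →ₗ[F] S →ₗ[F] F) (hB : ∀ u v, B u v = B v u) (h2 : (2 : F) ≠ 0) (d : F) (a b : S)
    (hfirst : B a a = d * B b b) :
    reK B d (a, b) (conjK (a, b)) = 2 * B a a ∧ (reK B d (a, b) (conjK (a, b)) = 0 ↔ B a a = 0) := by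
  have h := (conj_pairing B hB d a b).1
  have e : reK B d (a, b) (conjK (a, b)) = 2 * B a a := by rw [h, hfirst]; ring
  refine ⟨e, ?_⟩
  rw [e]
  constructor
  · intro h0
    rcases mul_eq_zero.mp h0 with h' | h'
    · exact absurd h' h2
    · exact h'
  · intro h0
    rw [h0, mul_zero]

/-- `P_K = span{λ₁, λ₂} = span{a, b}`: `λ₁ + λ₂ = 2a` and `λ₁ − λ₂ = 2√−d·b`, componentwise.
[cite: Markman2025SecantWeil, Lemma 2.2.1 (proof), p. 13 L11–15 / L21] -/
theorem plane_spanned_by_a_b (a b : S) :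
    ((a, b) + conjK (a, b) : S × S) = ((2 : F) • a, 0) ∧ ((a, b) - conjK (a, b) : S × S) = (0, (2 : F) • b) := by
  simp only [conjK, Prod.mk_add_mk, Prod.mk_sub_mk, add_neg_cancel, sub_neg_eq_add, sub_self, two_smul,
    and_self]

/-- The form on `P = span{a, b}` under the first equation: `Q(xa + yb) = x²(a,a) + 2xy(a,b) + y²(b,b) = (b,b)(dx² + y²)`.
[cite: Markman2025SecantWeil, Lemma 2.2.1, p. 13 L16–18 / L29–30] -/
theorem gram_on_P (B : S →ₗ[F] S →ₗ[F] F) (hB : ∀ u v, B u v = B v u) (d : F) (a b : S)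
    (hfirst : B a a = d * B b b) (hab : B a b = 0) (x y : F) :
    B (x • a + y • b) (x • a + y • b) = B b b * (d * x ^ 2 + y ^ 2) := by
  simp only [map_add, map_smul, LinearMap.add_apply, LinearMap.smul_apply, smul_eq_mul, hab, hB b a, hfirst]
  ring

/-- «`P` is isotropic … if and only if …»: the form vanishes identically on `P` iff `(a,a) = 0` (for `d ≠ 0`; the further
«iff `W₁ ∩ W₂ ≠ (0)`» is `second_equation` + [Ch, III.2.4]). [cite: Markman2025SecantWeil, Lemma 2.2.1, p. 13 L16–17] -/
theorem isotropic_iff (B : S →ₗ[F] S →ₗ[F] F) (hB : ∀ u v, B u v = B v u) (d : F) (hd : d ≠ 0) (a b : S)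
    (hfirst : B a a = d * B b b) (hab : B a b = 0) :
    (∀ x y : F, B (x • a + y • b) (x • a + y • b) = 0) ↔ B a a = 0 := by
  constructor
  · intro h
    have h1 := h 1 0
    simpa using h1
  · intro h0 x y
    have hbb : B b b = 0 := by
      rcases mul_eq_zero.mp (h0 ▸ hfirst).symm with h' | h'
      · exact absurd h' hd
      · exact h'
    rw [gram_on_P B hB d a b hfirst hab, hbb, zero_mul]

end General

section Ordered

variable {F : Type*} [Field F] [LinearOrder F] [IsStrictOrderedRing F] {S : Type*} [AddCommGroup S] [Module F S]

/-- «The restriction of the pairing `(•, •)_S` to `P` is definite, if and only if `W₁ ∩ W₂ = (0)`» — the algebra over an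
ordered field with `d > 0`: under the first equation, if `(a,a) ≠ 0` then `Q(xa + yb) = (b,b)(dx² + y²)` vanishes only
for `x = y = 0` (DEFINITE); `d > 0` is what keeps `dx² + y²` anisotropic. [cite: Markman2025SecantWeil, Lemma 2.2.1, p. 13 L17–18] -/
theorem definite_of_ne (B : S →ₗ[F] S →ₗ[F] F) (hB : ∀ u v, B u v = B v u) (d : F) (hd : 0 < d) (a b : S)
    (hfirst : B a a = d * B b b) (hab : B a b = 0) (hne : B a a ≠ 0) (x y : F)
    (hQ : B (x • a + y • b) (x • a + y • b) = 0) : x = 0 ∧ y = 0 := by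
  rw [gram_on_P B hB d a b hfirst hab] at hQ
  have hbb : B b b ≠ 0 := by
    intro h; apply hne; rw [hfirst, h, mul_zero]
  rcases mul_eq_zero.mp hQ with h | h
  · exact absurd h hbb
  · have hx : d * x ^ 2 = 0 := by nlinarith [sq_nonneg x, sq_nonneg y, mul_nonneg hd.le (sq_nonneg x)]
    have hy : y ^ 2 = 0 := by nlinarith [sq_nonneg x, sq_nonneg y, mul_nonneg hd.le (sq_nonneg x)]
    refine ⟨?_, pow_eq_zero_iff (n := 2) (by norm_num) |>.mp hy⟩
    rcases mul_eq_zero.mp hx with h' | h'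
    · exact absurd h' hd.ne'
    · exact pow_eq_zero_iff (n := 2) (by norm_num) |>.mp h'

/-- … and conversely `(a,a) = 0` makes `P` isotropic (indeed totally isotropic); so, under the first equation and `d > 0`,
«definite» ⟺ `(a,a) ≠ 0` ⟺ (by `second_equation` and [Ch, III.2.4]) `W₁ ∩ W₂ = (0)`.
[cite: Markman2025SecantWeil, Lemma 2.2.1, p. 13 L16–18] -/
theorem definite_iff (B : S →ₗ[F] S →ₗ[F] F) (hB : ∀ u v, B u v = B v u) (d : F) (hd : 0 < d) (a b : S)
    (hfirst : B a a = d * B b b) (hab : B a b = 0) :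
    (∀ x y : F, B (x • a + y • b) (x • a + y • b) = 0 → x = 0 ∧ y = 0) ↔ B a a ≠ 0 := by
  constructor
  · intro h h0
    have := h 1 0 (by rw [(isotropic_iff B hB d hd.ne' a b hfirst hab).mpr h0 1 0])
    exact one_ne_zero this.1
  · intro hne x y hQ
    exact definite_of_ne B hB d hd a b hfirst hab hne x y hQ

end Ordered

end Literature.AlgebraicGeometry.Markman2025.SecantPlane
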